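import Summits.RiemannHypothesis.RiemannHypothesis.Theorems.PfPersistenceCoefficientRigidityZeroWidth
import Summits.RiemannHypothesis.RiemannHypothesis.Theorems.PfPersistenceCoefficientRigidityTrigSum
import HarnessLib

/-!
# Coefficient rigidity of window positivity, IV-b: finitely many sites, finite table edits
(pub-rhpf cand-7, gen 9; mechanism/rigidity campaign; no RH claims)

Fourth part of `PfPersistenceCoefficientRigidity`.  Part III-b proved that ONE site `x₀ > 0` with
ONE coefficient `λ ≠ 0` already destroys positivity.  Here: ANY finite real perturbation
`W_{c,x}(F) = W(F) + ∑_{i ∈ E} c_i (F(x_i) + F(-x_i))` of Weil's explicit-formula functional at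
pairwise distinct sites `x_i > 0`, with at least one `c_i ≠ 0`, is negative on some test function.
ALL STATEMENTS ARE PROVED (no `sorry`, no new axioms, RH only inside a `by_cases`); no sentence
of this file is DATA.

* `exists_multiSiteQuadratic_neg` — **MAIN THEOREM (RH-free)**: `∃ g` test with
  `Re W_{c,x}(g ⋆ g̃) < 0`.
* `multiSiteQuadratic_nonneg_iff` —
  `(∀ test g, Re W_{c,x}(g ⋆ g̃) ≥ 0) ↔ ((∀ i ∈ E, c_i = 0) ∧ RiemannHypothesis)`:
  inside the finite-dimensional family the positive set is the single point `c = 0` or empty —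
  which of the two is RH itself and is NOT claimed.
* `not_positivity_of_finiteEdit` — changing finitely many entries `n ≥ 2` of `ζ`'s weight table
  `Λ(n)/√n` (at least one of them actually changed, to any real values) violates
  `ExplicitDatum.Positivity`.  In particular no finite set of prime-power deletions and no finite
  re-weighting is compatible with positivity.

Mechanism.  `¬RH` branch: part I's sinking ground energy beats the bounded site terms.  RH branch:
the wave packets `g_{R,t₀}` of part III-a; their autocorrelation at lag `x` has real part
`cos(t₀ x)·I_R(x)` with `|I_R(x) - I_R(0)| ≤ 2K|x|` (`K` a Lipschitz constant of the plateau bump)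
and `I_R(0) ≥ R`, so the site sum is `2 I_R(0) P(t₀) + O(1)` with the trigonometric sum
`P(t) = ∑ c_i cos(t x_i)`; part IV-a (`exists_Icc_trigSum_le`) gives an interval where `P ≤ -δ < 0`,
inside which `exists_far_from_ordinates` puts the carrier off the ordinates, making the zero side
`O(R⁻²)`.  Total `≤ O(1) - 2δR < 0`.

References: E. Bombieri, *Remarks on Weil's quadratic functional in the theory of prime numbers
I*, Rend. Lincei (9) 11 (2000) 183–233, §3; A. Weil (1952); H. Bohr (1925) for IV-a.
-/

set_option linter.dupNamespace false

noncomputable section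

open Complex Filter Set MeasureTheory
open scoped Real Topology ComplexConjugate NNReal

namespace Summit.RiemannHypothesis.RiemannHypothesis.Theorems.PfPersistenceCoefficientRigidity

open Literature.NumberTheory.LFunctions
open Literature.NumberTheory.LFunctions.WeilConverse
open Summit.RiemannHypothesis.RiemannHypothesis.Theorems.PfPersistenceDownCone
open Summit.RiemannHypothesis.RiemannHypothesis.Theorems.PfPersistenceBarrier

/-! ## §17 The overlap integral `I_R(x) = ∫ ψ(u/R) ψ((u - x)/R) du` is almost constant in `x` -/

/-- The overlap integral `I_R(x) = ∫ ψ(u/R) ψ((u - x)/R) du` of the dilated plateau bump.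
[this work] -/
def overlap (R x : ℝ) : ℝ := ∫ u, plateau (u / R) * plateau ((u - x) / R)

/-- `Re (g_{R,t₀} ⋆ g̃_{R,t₀})(x) = cos(t₀ x) · I_R(x)` (part III-a, renamed). [this work] -/
theorem re_weilConv_wavePacket_overlap (R t₀ x : ℝ) :
    (weilConv (wavePacket R t₀) (weilReflect (wavePacket R t₀)) x).re =
      Real.cos (t₀ * x) * overlap R x :=
  re_weilConv_wavePacket R t₀ x

/-- `I_R(0) ≥ R` (part III-a with `x₀ = 0`). [this work] -/
theorem le_overlap_zero {R : ℝ} (hR : 0 < R) : R ≤ overlap R 0 := by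
  have h := plateau_overlap_ge le_rfl (by linarith) hR
  rw [sub_zero] at h
  exact h

/-- The dilated plateau bump vanishes outside `[-R, R]`. [this work] -/
theorem plateau_dilate_eq_zero {R u : ℝ} (hR : 0 < R) (hu : u ∉ Icc (-R) R) :
    plateau (u / R) = 0 := by
  refine plateau.zero_of_le_dist ?_
  rw [dist_zero_right, Real.norm_eq_abs, abs_div, abs_of_pos hR,
    show plateau.rOut = 1 from rfl, le_div_iff₀ hR, one_mul]
  rw [mem_Icc, not_and_or, not_le, not_le] at hu
  rcases hu with h | h
  · linarith [neg_abs_le u]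
  · linarith [le_abs_self u]

/-- The integrand of `I_R(x)` is integrable. [this work] -/
theorem integrable_plateau_overlap {R : ℝ} (hR : 0 < R) (x : ℝ) :
    Integrable fun u : ℝ ↦ plateau (u / R) * plateau ((u - x) / R) := by
  have hcont : Continuous fun u : ℝ ↦ plateau (u / R) * plateau ((u - x) / R) :=
    (plateau.continuous.comp (continuous_id.div_const R)).mul
      (plateau.continuous.comp ((continuous_id.sub continuous_const).div_const R))
  refine hcont.integrable_of_hasCompactSupport (HasCompactSupport.mul_right ?_)
  have e : (fun u : ℝ ↦ (plateau : ℝ → ℝ) (u / R)) =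
      (plateau : ℝ → ℝ) ∘ (Homeomorph.mulRight₀ R⁻¹ (inv_ne_zero hR.ne')) := by
    ext u
    simp [div_eq_mul_inv]
  rw [e]
  exact plateau.hasCompactSupport.comp_homeomorph _

/-- The plateau bump is Lipschitz (it is smooth with compact support). [folklore] -/
theorem exists_plateau_lipschitz : ∃ K : ℝ≥0, LipschitzWith K (plateau : ℝ → ℝ) :=
  ContDiff.lipschitzWith_of_hasCompactSupport plateau.hasCompactSupport
    (plateau.contDiff (n := 1)) (by simp)

/-- **Overlap approximation**: `|I_R(x) - I_R(0)| ≤ 2K|x|` for a Lipschitz constant `K` of the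
plateau bump, uniformly in `R > 0` (`|ψ((u-x)/R) - ψ(u/R)| ≤ K|x|/R` on `[-R, R]`, zero weight
outside). [this work] -/
theorem abs_overlap_sub_overlap_zero_le {R : ℝ} (hR : 0 < R) {K : ℝ≥0}
    (hK : LipschitzWith K (plateau : ℝ → ℝ)) (x : ℝ) :
    |overlap R x - overlap R 0| ≤ 2 * (K : ℝ) * |x| := by
  set D : ℝ → ℝ := fun u ↦
    plateau (u / R) * plateau ((u - x) / R) - plateau (u / R) * plateau ((u - 0) / R) with hD
  have hDeq : overlap R x - overlap R 0 = ∫ u, D u := by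
    rw [hD, integral_sub (integrable_plateau_overlap hR x) (integrable_plateau_overlap hR 0)]
    rfl
  have hpt : ∀ u : ℝ, |D u| ≤ (K : ℝ) * |x| / R := by
    intro u
    have hlip : |plateau ((u - x) / R) - plateau ((u - 0) / R)| ≤ (K : ℝ) * |x| / R := by
      have h := hK.dist_le_mul ((u - x) / R) ((u - 0) / R)
      rw [Real.dist_eq, Real.dist_eq] at h
      have e : (u - x) / R - (u - 0) / R = -(x / R) := by ring
      rw [e, abs_neg, abs_div, abs_of_pos hR] at h
      calc |plateau ((u - x) / R) - plateau ((u - 0) / R)| ≤ K * (|x| / R) := h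
        _ = (K : ℝ) * |x| / R := by ring
    simp only [hD]
    rw [← mul_sub, abs_mul, abs_of_nonneg plateau.nonneg]
    calc plateau (u / R) * |plateau ((u - x) / R) - plateau ((u - 0) / R)|
        ≤ 1 * ((K : ℝ) * |x| / R) :=
          mul_le_mul plateau.le_one hlip (abs_nonneg _) zero_le_one
      _ = (K : ℝ) * |x| / R := one_mul _
  have hvanish : ∀ u ∉ Icc (-R) R, |D u| = 0 := by
    intro u hu
    simp only [hD, plateau_dilate_eq_zero hR hu, zero_mul, sub_self, abs_zero]
  have hcontD : Continuous D := by
    simp only [hD]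
    exact ((plateau.continuous.comp (continuous_id.div_const R)).mul
      (plateau.continuous.comp ((continuous_id.sub continuous_const).div_const R))).sub
      ((plateau.continuous.comp (continuous_id.div_const R)).mul
        (plateau.continuous.comp ((continuous_id.sub continuous_const).div_const R)))
  rw [hDeq]
  calc |∫ u, D u| ≤ ∫ u, |D u| := abs_integral_le_integral_abs
    _ = ∫ u in Icc (-R) R, |D u| := (setIntegral_eq_integral_of_forall_compl_eq_zero hvanish).symm
    _ ≤ ∫ _ in Icc (-R) R, (K : ℝ) * |x| / R :=
        setIntegral_mono (hcontD.abs.integrableOn_Icc) (continuous_const.integrableOn_Icc)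
          fun u ↦ hpt u
    _ = 2 * (K : ℝ) * |x| := by
        rw [setIntegral_const, Real.volume_real_Icc_of_le (by linarith), smul_eq_mul]
        field_simp
        ring

/-! ## §18 The finitely-many-sites functional -/

/-- `W_{c,x}(g ⋆ g̃) = W(g ⋆ g̃) + ∑_{i ∈ E} c_i ((g ⋆ g̃)(x_i) + (g ⋆ g̃)(-x_i))`: Weil's quadratic
functional perturbed by finitely many even point masses. [this work] -/
def multiSiteQuadratic {ι : Type*} (E : Finset ι) (c x : ι → ℝ) (g : ℝ → ℂ) : ℂ :=
  weilQuadratic g +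
    ∑ i ∈ E, (c i : ℂ) * (weilConv g (weilReflect g) (x i) + weilConv g (weilReflect g) (-(x i)))

/-- Real part: `Re W_{c,x}(g ⋆ g̃) = Re W(g ⋆ g̃) + ∑ 2 c_i Re (g ⋆ g̃)(x_i)`. [this work] -/
theorem multiSiteQuadratic_re {ι : Type*} (E : Finset ι) (c x : ι → ℝ) (g : ℝ → ℂ) :
    (multiSiteQuadratic E c x g).re =
      (weilQuadratic g).re + ∑ i ∈ E, 2 * c i * (weilConv g (weilReflect g) (x i)).re := by
  rw [multiSiteQuadratic, Complex.add_re, Complex.re_sum]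
  congr 1
  exact Finset.sum_congr rfl fun i _ ↦ re_siteTerm (c i) (x i) g

/-- With all coefficients zero the functional is Weil's. [this work] -/
theorem multiSiteQuadratic_eq_of_forall_eq_zero {ι : Type*} {E : Finset ι} {c : ι → ℝ}
    (hc : ∀ i ∈ E, c i = 0) (x : ι → ℝ) (g : ℝ → ℂ) :
    multiSiteQuadratic E c x g = weilQuadratic g := by
  rw [multiSiteQuadratic, Finset.sum_eq_zero fun i hi ↦ by rw [hc i hi]; simp, add_zero]

/-- The site sum is bounded by `2 (∑ |c_i|) ‖g‖₂²` for every test function. [this work] -/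
theorem re_siteSum_le {ι : Type*} (E : Finset ι) (c x : ι → ℝ) {g : ℝ → ℂ} (hg : IsWeilTest g) :
    (∑ i ∈ E, (c i : ℂ) *
        (weilConv g (weilReflect g) (x i) + weilConv g (weilReflect g) (-(x i)))).re ≤
      ∑ i ∈ E, 2 * |c i| * ∫ u, ‖g u‖ ^ 2 := by
  rw [Complex.re_sum]
  exact Finset.sum_le_sum fun i _ ↦ re_siteTerm_le (c i) (x i) hg

/-! ## §19 Main theorem: every non-trivial finite perturbation is non-positive -/

/-- **RH branch**: under RH, for pairwise distinct sites `x_i > 0` and coefficients not all zero,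
some wave packet has `Re W_{c,x}(g ⋆ g̃) < 0`. [this work] -/
theorem exists_multiSiteQuadratic_neg_of_riemannHypothesis (hRH : RiemannHypothesis)
    {ι : Type*} {E : Finset ι} {c x : ι → ℝ} (hx : ∀ i ∈ E, 0 < x i) (hinj : Set.InjOn x E)
    (hc : ∃ i ∈ E, c i ≠ 0) :
    ∃ g : ℝ → ℂ, IsWeilTest g ∧ (multiSiteQuadratic E c x g).re < 0 := by
  obtain ⟨a, b, δ, hab, hδ, hP⟩ := exists_Icc_trigSum_le hx hinj hc
  obtain ⟨t₀, ht₀, d, hd, hsep⟩ := exists_far_from_ordinates hab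
  obtain ⟨K, hK⟩ := exists_plateau_lipschitz
  set S := ∑' ρ : ZetaZeros.riemannZetaNontrivialZeros, weilZeroWeight (ρ : ℂ) with hSdef
  set M := (weilDecayConst plateauC * ((1 + 2 * t₀ ^ 2) * (2 + 1 / d ^ 2))) ^ 2 with hMdef
  set A := ∑ i ∈ E, |c i| * x i with hAdef
  have hS : 0 ≤ S := tsum_nonneg fun ρ ↦ weilZeroWeight_nonneg ρ.2
  have hM : 0 ≤ M := sq_nonneg _
  have hA : 0 ≤ A := Finset.sum_nonneg fun i hi ↦ mul_nonneg (abs_nonneg _) (hx i hi).le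
  have hK0 : (0 : ℝ) ≤ K := K.2
  set R := max 1 ((M * S + 4 * K * A + 1) / (2 * δ)) with hRdef
  have hR1 : 1 ≤ R := le_max_left _ _
  have hR0 : 0 < R := by linarith
  have hRδ : M * S + 4 * K * A + 1 ≤ 2 * δ * R := by
    have h := le_max_right 1 ((M * S + 4 * K * A + 1) / (2 * δ))
    rw [← hRdef, div_le_iff₀ (by positivity)] at h
    linarith
  have hg := isWeilTest_wavePacket hR0 t₀
  refine ⟨wavePacket R t₀, hg, ?_⟩
  rw [multiSiteQuadratic_re, ← combShapeDetection_zeroForm_eq_weilQuadratic hg]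
  simp_rw [re_weilConv_wavePacket_overlap]
  have hZ : (zeroForm (wavePacket R t₀)).re ≤ M / R ^ 2 * S :=
    re_zeroForm_wavePacket_le hRH hR0 hd hsep
  have hZ' : M / R ^ 2 * S ≤ M * S :=
    mul_le_mul_of_nonneg_right (div_le_self hM (by nlinarith)) hS
  have hsum : ∑ i ∈ E, 2 * c i * (Real.cos (t₀ * x i) * overlap R (x i)) =
      2 * overlap R 0 * ∑ i ∈ E, c i * Real.cos (t₀ * x i) +
        2 * ∑ i ∈ E, c i * Real.cos (t₀ * x i) * (overlap R (x i) - overlap R 0) := by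
    rw [Finset.mul_sum, Finset.mul_sum, ← Finset.sum_add_distrib]
    exact Finset.sum_congr rfl fun i _ ↦ by ring
  have hO0 : R ≤ overlap R 0 := le_overlap_zero hR0
  have hPt : ∑ i ∈ E, c i * Real.cos (t₀ * x i) ≤ -δ := hP t₀ ht₀
  have herr : ∑ i ∈ E, c i * Real.cos (t₀ * x i) * (overlap R (x i) - overlap R 0) ≤
      2 * K * A := by
    rw [hAdef, Finset.mul_sum]
    refine Finset.sum_le_sum fun i hi ↦ ?_
    have h1 : |overlap R (x i) - overlap R 0| ≤ 2 * (K : ℝ) * |x i| :=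
      abs_overlap_sub_overlap_zero_le hR0 hK (x i)
    rw [abs_of_pos (hx i hi)] at h1
    have h2 : |c i * Real.cos (t₀ * x i)| ≤ |c i| := by
      rw [abs_mul]
      exact mul_le_of_le_one_right (abs_nonneg _) (Real.abs_cos_le_one _)
    calc c i * Real.cos (t₀ * x i) * (overlap R (x i) - overlap R 0)
        ≤ |c i * Real.cos (t₀ * x i) * (overlap R (x i) - overlap R 0)| := le_abs_self _
      _ = |c i * Real.cos (t₀ * x i)| * |overlap R (x i) - overlap R 0| := abs_mul _ _
      _ ≤ |c i| * (2 * (K : ℝ) * x i) := mul_le_mul h2 h1 (abs_nonneg _) (abs_nonneg _)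
      _ = 2 * K * (|c i| * x i) := by ring
  have hmain : 2 * overlap R 0 * ∑ i ∈ E, c i * Real.cos (t₀ * x i) ≤ 2 * R * (-δ) := by
    have hPneg : ∑ i ∈ E, c i * Real.cos (t₀ * x i) ≤ 0 := by linarith
    have h := mul_le_mul_of_nonpos_right hO0 hPneg
    nlinarith
  rw [hsum]
  linarith

/-- **MAIN THEOREM (RH-free).**  For pairwise distinct sites `x_i > 0` (`i ∈ E`, finite) and real
coefficients `c_i` not all zero, the perturbed functional
`W_{c,x}(F) = W(F) + ∑ c_i (F(x_i) + F(-x_i))` is negative on some test function: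
`Re W_{c,x}(g ⋆ g̃) < 0`.  (`by_cases` on RH: wave packets under RH, the sinking ground energy of
part I under `¬RH`.) [this work] -/
theorem exists_multiSiteQuadratic_neg {ι : Type*} {E : Finset ι} {c x : ι → ℝ}
    (hx : ∀ i ∈ E, 0 < x i) (hinj : Set.InjOn x E) (hc : ∃ i ∈ E, c i ≠ 0) :
    ∃ g : ℝ → ℂ, IsWeilTest g ∧ (multiSiteQuadratic E c x g).re < 0 := by
  by_cases hRH : RiemannHypothesis
  · exact exists_multiSiteQuadratic_neg_of_riemannHypothesis hRH hx hinj hc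
  · obtain ⟨a, -, -, g, hg, -, hnorm, hW⟩ :=
      exists_weilQuadratic_lt_of_not_riemannHypothesis hRH (∑ i ∈ E, 2 * |c i|) 0
    refine ⟨g, hg, ?_⟩
    rw [multiSiteQuadratic, Complex.add_re]
    have h := re_siteSum_le E c x hg
    simp_rw [hnorm, mul_one] at h
    linarith

/-- Sites given as a finite set of positive reals. [this work] -/
theorem exists_multiSiteQuadratic_neg_finset {X : Finset ℝ} {c : ℝ → ℝ} (hX : ∀ x ∈ X, 0 < x)
    (hc : ∃ x ∈ X, c x ≠ 0) :
    ∃ g : ℝ → ℂ, IsWeilTest g ∧ (multiSiteQuadratic X c id g).re < 0 :=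
  exists_multiSiteQuadratic_neg hX (Set.injOn_id _) hc

/-! ## §20 Characterisation of the positive set of the finite-dimensional family -/

/-- **Rigidity of the coefficients.**  For pairwise distinct sites `x_i > 0`:
`(∀ test g, Re W_{c,x}(g ⋆ g̃) ≥ 0) ↔ ((∀ i ∈ E, c_i = 0) ∧ RiemannHypothesis)`.
The positive set inside the family `{W_{c,x}}_c ≅ ℝ^E` is `{0}` or `∅`; which of the two is RH
(Weil's criterion, imported) and is NOT claimed. [this work] -/
theorem multiSiteQuadratic_nonneg_iff {ι : Type*} {E : Finset ι} {c x : ι → ℝ}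
    (hx : ∀ i ∈ E, 0 < x i) (hinj : Set.InjOn x E) :
    (∀ g : ℝ → ℂ, IsWeilTest g → 0 ≤ (multiSiteQuadratic E c x g).re) ↔
      (∀ i ∈ E, c i = 0) ∧ RiemannHypothesis := by
  constructor
  · intro h
    have hc : ∀ i ∈ E, c i = 0 := by
      by_contra hne
      push Not at hne
      obtain ⟨g, hg, hneg⟩ := exists_multiSiteQuadratic_neg hx hinj hne
      exact absurd (h g hg) (not_le.2 hneg)
    refine ⟨hc, (siteQuadratic_zero_nonneg_iff_riemannHypothesis 1).1 fun g hg ↦ ?_⟩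
    rw [siteQuadratic_zero, ← multiSiteQuadratic_eq_of_forall_eq_zero hc x g]
    exact h g hg
  · rintro ⟨hc, hRH⟩ g hg
    rw [multiSiteQuadratic_eq_of_forall_eq_zero hc x g, ← siteQuadratic_zero 1 g]
    exact (siteQuadratic_zero_nonneg_iff_riemannHypothesis 1).2 hRH g hg

/-- Hence: if the family is positive at `c`, then `c = 0` on `E` (RH-free). [this work] -/
theorem forall_eq_zero_of_multiSiteQuadratic_nonneg {ι : Type*} {E : Finset ι} {c x : ι → ℝ}
    (hx : ∀ i ∈ E, 0 < x i) (hinj : Set.InjOn x E)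
    (h : ∀ g : ℝ → ℂ, IsWeilTest g → 0 ≤ (multiSiteQuadratic E c x g).re) :
    ∀ i ∈ E, c i = 0 :=
  ((multiSiteQuadratic_nonneg_iff hx hinj).1 h).1

/-! ## §21 Finite edits of `ζ`'s weight table -/

/-- A table `w` agreeing with `ζ`'s outside a finite set `E ⊆ ℕ` has quadratic functional
`W_{c,x}` with sites `log n` and coefficients `c_n = Λ(n)/√n - w(n)`, `n ∈ E`. [this work] -/
theorem finiteEdit_quadratic_eq {w : ℕ → ℝ} {E : Finset ℕ} (hw : ∀ n ∉ E, w n = zetaTable n)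
    {g : ℝ → ℂ} (hg : IsWeilTest g) :
    (tableDatum w).quadratic g =
      multiSiteQuadratic E (fun n ↦ zetaTable n - w n) (fun n : ℕ ↦ Real.log n) g := by
  obtain ⟨a, -, ha⟩ := hg.exists_tsupport_subset_Icc
  obtain ⟨N₁, hN₁⟩ := exists_window_le_log_succ_half a
  set N := max N₁ (E.sup id) with hNdef
  have hN : a ≤ Real.log ((N : ℝ) + 1) / 2 := by
    refine hN₁.trans ?_
    have : (N₁ : ℝ) ≤ N := by exact_mod_cast le_max_left _ _
    gcongr
  have hsupp : tsupport g ⊆ Icc (-(Real.log ((N : ℝ) + 1) / 2)) (Real.log ((N : ℝ) + 1) / 2) :=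
    ha.trans (Icc_subset_Icc (by linarith) hN)
  have hEN : E ⊆ Finset.range (N + 1) := fun n hn ↦ by
    rw [Finset.mem_range]
    have h1 : n ≤ E.sup id := Finset.le_sup (f := id) hn
    have h2 : E.sup id ≤ N := le_max_right _ _
    omega
  rw [tableDatum_quadratic_eq_add_sum zetaTable w hg N hsupp, tableDatum_zetaTable_quadratic,
    multiSiteQuadratic]
  congr 1
  symm
  refine Finset.sum_subset hEN fun n _ hnE ↦ ?_
  rw [hw n hnE, sub_self]
  simp

/-- **No finite edit of `ζ`'s weight table is positive.**  If `w` agrees with `Λ(n)/√n` outside a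
finite set `E` of integers `≥ 2` and differs from it somewhere on `E`, then `tableDatum w` violates
`ExplicitDatum.Positivity` (RH-free).  Covers every finite set of prime-power deletions, every
finite re-weighting, and every finite insertion at non-prime-powers `n ≥ 2`. [this work] -/
theorem not_positivity_of_finiteEdit {w : ℕ → ℝ} {E : Finset ℕ} (hE : ∀ n ∈ E, 2 ≤ n)
    (hw : ∀ n ∉ E, w n = zetaTable n) (hne : ∃ n ∈ E, w n ≠ zetaTable n) :
    ¬ (tableDatum w).Positivity := by
  intro hP
  have hpos : ∀ n ∈ E, (0 : ℝ) < n := fun n hn ↦ by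
    have := hE n hn
    exact_mod_cast (by omega : 0 < n)
  have hx : ∀ n ∈ E, 0 < Real.log (n : ℝ) := fun n hn ↦
    Real.log_pos (by exact_mod_cast lt_of_lt_of_le (by norm_num) (hE n hn))
  have hinj : Set.InjOn (fun n : ℕ ↦ Real.log (n : ℝ)) E := fun m hm n hn h ↦ by
    have h' : (m : ℝ) = n :=
      Real.log_injOn_pos (Set.mem_Ioi.2 (hpos m hm)) (Set.mem_Ioi.2 (hpos n hn)) h
    exact_mod_cast h'
  have hc : ∃ n ∈ E, zetaTable n - w n ≠ 0 := by
    obtain ⟨n, hn, hne⟩ := hne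
    exact ⟨n, hn, sub_ne_zero.2 hne.symm⟩
  obtain ⟨g, hg, hneg⟩ := exists_multiSiteQuadratic_neg hx hinj hc
  have h := hP g hg
  rw [finiteEdit_quadratic_eq hw hg] at h
  exact absurd h (not_le.2 hneg)

/-- In particular: deleting any non-empty finite set `E` of prime powers from `ζ`'s table
(`deleteTable`, `PfPersistenceDownCone`) violates positivity (RH-free; the single deletion is part
III-b). [this work] -/
theorem deleteTable_finset_not_positivity {E : Finset ℕ}
    (hE : ∀ n ∈ E, ArithmeticFunction.vonMangoldt n ≠ 0) (hne : E.Nonempty) :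
    ¬ (tableDatum (deleteTable (E : Set ℕ))).Positivity := by
  classical
  have hE2 : ∀ n ∈ E, 2 ≤ n := fun n hn ↦
    (ArithmeticFunction.vonMangoldt_ne_zero_iff.1 (hE n hn)).two_le
  refine not_positivity_of_finiteEdit hE2 (fun n hn ↦ ?_) ?_
  · unfold deleteTable
    simp [hn]
  · obtain ⟨n, hn⟩ := hne
    refine ⟨n, hn, ?_⟩
    have hn0 : (0 : ℝ) < n := by exact_mod_cast lt_of_lt_of_le (by norm_num) (hE2 n hn)
    have hz : zetaTable n ≠ 0 := div_ne_zero (hE n hn) (Real.sqrt_ne_zero'.2 hn0)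
    unfold deleteTable
    simpa [hn] using hz.symm

end Summit.RiemannHypothesis.RiemannHypothesis.Theorems.PfPersistenceCoefficientRigidity

end
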